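import Mathlib
import Literature.Probability.MarkovChains.TotalVariation
import Summits.Ventures.LatticeQCDFlow.Scaling.ImportanceWeights
import Summits.Ventures.LatticeQCDFlow.Scaling.BlockDefect

/-!
# LatticeQCDFlow / Scaling — the receptive-field (log-volume) law (T2-Z)

HONEST FRAMING: exact (Metropolis-corrected) sampling algorithms for lattice gauge theory;
figures of merit are autocorrelation/cost numbers at stated couplings and volumes; no
continuum-physics claim.

Venture `LatticeQCDFlow` (cell pub-lqcd), topic `Scaling`, THEORY-2.md §3.6 / §4 T2-Z (v1.6),
prepared for landing by the theory seat (FANOUT row 29) from `HOME/THEORY-2-Sketch.lean` v1.8,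
rebased on the tree's `Scaling/BlockDefect` (`blockMarg`, `ess_blockDefect_volume_law`, T2-I″).

T2-I″ with an exponentially small per-block defect: if the target's block marginals stay at
total variation `≥ κ e^{−s/ξ}` from the model's (independent) block laws — `s` the width of the
cut the model cannot see across, `ξ` a clustering length, `κ` from T2-N (`CovDefect`) — then
`ESS ≥ η` forces `s ≥ (ξ/2) · log(2 m κ² / log(1/η))` (`receptiveField_log_volume_law`): the
receptive-field radius of a fixed-architecture flow must grow at least LOGARITHMICALLY in the
number of blocks `m`, i.e. in the volume.  The clustering input (the hypothesis `hdef` uniformly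
in the volume) is the conjecture `Conjectures.ClusteringFloor` (U″) of THEORY-2.md §4 — a theorem
at strong coupling via the cluster expansion, a conjecture only in its volume-uniformity at
intermediate β (`d ≥ 3`).  Printed counterpart: the `L`-CNF receptive-field ablations of
arXiv:2211.07541 §IV–V and of Komijani–Marinkovic 2025.

Elementary (`[folklore]`-level); farm `lean check` rc 0, no `sorry`.
-/

namespace Summit.Ventures.LatticeQCDFlow.Theory2

open Finset
open Literature.Probability.MarkovChains

variable {X : Type*} [Fintype X]

section ReceptiveField

variable {m : ℕ} {Z : Type*} [Fintype Z] [DecidableEq Z]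

/-- **T2-Z (receptive-field log-volume law; proved).** [folklore] -/
theorem receptiveField_log_volume_law {p : (Fin m → Z) → ℝ} (hp : ∀ φ, 0 < p φ)
    (hp1 : ∑ φ, p φ = 1) {qb : Fin m → Z → ℝ} (hq : ∀ i z, 0 < qb i z)
    (hq1 : ∀ i, ∑ z, qb i z = 1) {κ ξ s η : ℝ} (hκ : 0 < κ) (hξ : 0 < ξ) (hη : 0 < η)
    (hη1 : η < 1) (hm : 0 < m)
    (hdef : ∀ i, κ * Real.exp (-(s / ξ)) ≤ tvDist (blockMarg p i) (qb i))
    (hess : η ≤ essFrac p (blockProd qb)) :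
    ξ / 2 * Real.log (2 * m * κ ^ 2 / Real.log η⁻¹) ≤ s := by
  have hξ0 : ξ ≠ 0 := hξ.ne'
  set E := Real.exp (-(s / ξ)) with hE
  have hE0 : 0 < E := Real.exp_pos _
  have hδ : 0 ≤ κ * E := by positivity
  have h1 := ess_blockDefect_volume_law hp hp1 hq hq1 hδ hdef
  have h2 : Real.log η ≤ -((m : ℝ) * (2 * (κ * E) ^ 2)) :=
    (Real.log_le_iff_le_exp hη).2 (hess.trans h1)
  set B := Real.log η⁻¹ with hB
  have hB0 : 0 < B := by rw [hB, Real.log_inv]; linarith [Real.log_neg hη hη1]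
  have hm' : (0 : ℝ) < m := by exact_mod_cast hm
  have hA0 : 0 < 2 * (m : ℝ) * κ ^ 2 := by positivity
  have h3 : 2 * (m : ℝ) * κ ^ 2 * E ^ 2 ≤ B := by
    rw [hB, Real.log_inv]
    rw [mul_pow] at h2
    nlinarith [h2]
  have h4 : E ^ 2 ≤ B / (2 * m * κ ^ 2) := by
    rw [le_div_iff₀ hA0]; linarith [h3]
  have h5 : 2 * (-(s / ξ)) ≤ Real.log (B / (2 * m * κ ^ 2)) := by
    have h := Real.log_le_log (pow_pos hE0 2) h4
    rw [Real.log_pow, hE, Real.log_exp] at h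
    push_cast at h
    linarith
  have h6 : Real.log (2 * m * κ ^ 2 / B) = -Real.log (B / (2 * m * κ ^ 2)) := by
    rw [← Real.log_inv, inv_div]
  rw [h6]
  have h7 : -Real.log (B / (2 * m * κ ^ 2)) ≤ 2 * (s / ξ) := by linarith
  calc ξ / 2 * -Real.log (B / (2 * ↑m * κ ^ 2)) ≤ ξ / 2 * (2 * (s / ξ)) :=
        mul_le_mul_of_nonneg_left h7 (by positivity)
    _ = s := by field_simp

end ReceptiveField

end Summit.Ventures.LatticeQCDFlow.Theory2
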